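import Summits.CriticalPhenomena.PercolationContinuityZ3.Theorems.PercBudgetLadderPinholeClosingShellHalving

/-!
# Crux `PercBudgetLadder.PinholeClosing` (stmt-CriticalPhenomena-5249): the one-`∃` restatement `PinholeClosingHalved`, PROVED

Lead `prover-line-stmt-CriticalPhenomena-5249-c4-0`, 2026-08-17.  A second restatement option for the tenure planner,
syntactically closest to the typed decl (single `∃ c'`, no `∃ j l' m`): for all `k`, `l ≥ 2`, `c > 0` there is `c' > 0`
such that for every `n ≥ 2`, if `box n → ∂ⁱⁿ box (l n)` is budget-`(k+1)` blocked with probability `≥ c`, then the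
annulus around the HALF-SIZE box, `box (n/2) → ∂ⁱⁿ box (12 l (n/2))`, is budget-`k` blocked with probability `≥ c'`
(`c' = c^N / N`, `N = (8l+1)³`).  This is exactly the `n ≥ 2` branch of lead c3's `pinholeClosingRestated_proof`
(`ShellHalving.exclusion` + `stub_shellSqueeze`, shell merge + two-sided cut + Harris/union bound), isolated as a
statement the route file can carry verbatim; its deciding theorem is pure logic (dry run
`Cruxes/PinholeClosing/RestatedGlue_c4_halved.lean`, `closes_halved`: in the descent take `n ≥ 2N + 2`, `m = n/2 ≥ N`,
`l' = 12 l`).  The guard `2 ≤ n` replaces `1 ≤ n` because `box 3 (1/2) = box 3 0` makes the conclusion event empty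
(`Negative.blockedEv_eq_empty`).  The typed decl (conclusion at the SAME inner radius `n`, outer radius `2 l n`) is NOT
claimed — see `…Dichotomy.lean` and `Cruxes/PinholeClosing/LEAD-c4-NOTE-1.md`.  No definitions in this file.
-/

noncomputable section

namespace Summit.CriticalPhenomena.PercolationContinuityZ3.Theorems

open MeasureTheory
open scoped Classical
open Literature.Probability.Percolation Literature.Probability.LatticeModels
open Summit.CriticalPhenomena.PercolationContinuityZ3.Theses
open Summit.CriticalPhenomena.PercolationContinuityZ3.Theorems.PinholeClosing

/-- **`PinholeClosingHalved`, proved.**  For all `k`, `l ≥ 2`, `c > 0` there is `c' > 0` (namely `c^N/N`, `N = (8l+1)³`)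
such that for every `n ≥ 2`: budget-`(k+1)` blocking of `box n → ∂ⁱⁿ box (l n)` with probability `≥ c` implies
budget-`k` blocking of `box (n/2) → ∂ⁱⁿ box (12 l (n/2))` with probability `≥ c'`.  Proof: `u = n/2` (so `2u ≤ n ≤ 3u`),
raise the premise's outer radius from `l n` to `3 l u` (`Negative.blockProb_mono_aspect`), then `stub_shellSqueeze` with
the deterministic `ShellHalving.exclusion`. -/
theorem pinholeClosingHalved_proof :
    ∀ (k l : ℕ) (c : ℝ), 2 ≤ l → 0 < c → ∃ c' : ℝ, 0 < c' ∧ ∀ n : ℕ, 2 ≤ n → c ≤ (Literature.Probability.Percolation.bondPercolation (Literature.Probability.LatticeModels.zdGraph 3) (Literature.Probability.Percolation.criticalProbI 3)).real {ω | ∃ S : Finset (Sym2 (Literature.Probability.LatticeModels.Site 3)), S.card ≤ k + 1 ∧ ¬ ∃ x ∈ Literature.Probability.LatticeModels.box 3 n, ∃ y ∈ Literature.Probability.LatticeModels.innerBoundary (Literature.Probability.LatticeModels.zdGraph 3) (Literature.Probability.LatticeModels.box 3 (l * n)), (ω \ ↑S) ∈ Literature.Probability.Percolation.openConnIn ↑(Literature.Probability.LatticeModels.box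 3 (l * n)) x y} → c' ≤ (Literature.Probability.Percolation.bondPercolation (Literature.Probability.LatticeModels.zdGraph 3) (Literature.Probability.Percolation.criticalProbI 3)).real {ω | ∃ S : Finset (Sym2 (Literature.Probability.LatticeModels.Site 3)), S.card ≤ k ∧ ¬ ∃ x ∈ Literature.Probability.LatticeModels.box 3 (n / 2), ∃ y ∈ Literature.Probability.LatticeModels.innerBoundary (Literature.Probability.LatticeModels.zdGraph 3) (Literature.Probability.LatticeModels.box 3 (12 * l * (n / 2))), (ω \ ↑S) ∈ Literature.Probability.Percolation.openConnIn ↑(Literature.Probability.LatticeModels.box 3 (12 * l * (n / 2))) x y} := by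
  intro k l c hl hc
  have hNpos : (0 : ℝ) < (((8 * l + 1) ^ 3 : ℕ) : ℝ) := by positivity
  refine ⟨c ^ ((8 * l + 1) ^ 3) / (((8 * l + 1) ^ 3 : ℕ) : ℝ), div_pos (pow_pos hc _) hNpos, ?_⟩
  intro n hn2 hprem
  -- u = ⌊n/2⌋ : caps at aspect 3lu ≥ ln, squeeze + exclusion
  have hu : 1 ≤ n / 2 := by omega
  have h2u : 2 * (n / 2) ≤ n := by omega
  have h3u : n ≤ 3 * (n / 2) := by omega
  have hln : n ≤ l * n := Nat.le_mul_of_pos_left n (by omega)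
  have hl3 : l * n ≤ 3 * l * (n / 2) :=
    calc l * n ≤ l * (3 * (n / 2)) := Nat.mul_le_mul_left l h3u
      _ = 3 * l * (n / 2) := by ring
  have hcap := hprem.trans (Negative.blockProb_mono_aspect (k := k + 1) hln hl3)
  have hsq := stub_shellSqueeze (k + 1) n l (n / 2) c hc.le hcap (fun ω hω hcaps =>
    ShellHalving.exclusion (k + 1) n l (n / 2) (by omega) hl hu h2u h3u ω hω hcaps)
  simp only [Nat.add_sub_cancel] at hsq
  rw [div_le_iff₀ hNpos]
  exact hsq.trans_eq (mul_comm _ _)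

/-- **Registered form** (`stub_pinholeClosingHalved` on stmt-CriticalPhenomena-5249): the one-`∃` restated crux, by
`pinholeClosingHalved_proof`. -/
theorem stub_pinholeClosingHalved :
    ∀ (k l : ℕ) (c : ℝ), 2 ≤ l → 0 < c → ∃ c' : ℝ, 0 < c' ∧ ∀ n : ℕ, 2 ≤ n → c ≤ (Literature.Probability.Percolation.bondPercolation (Literature.Probability.LatticeModels.zdGraph 3) (Literature.Probability.Percolation.criticalProbI 3)).real {ω | ∃ S : Finset (Sym2 (Literature.Probability.LatticeModels.Site 3)), S.card ≤ k + 1 ∧ ¬ ∃ x ∈ Literature.Probability.LatticeModels.box 3 n, ∃ y ∈ Literature.Probability.LatticeModels.innerBoundary (Literature.Probability.LatticeModels.zdGraph 3) (Literature.Probability.LatticeModels.box 3 (l * n)), (ω \ ↑S) ∈ Literature.Probability.Percolation.openConnIn ↑(Literature.Probability.LatticeModels.box 3 (l * n)) x y} → c' ≤ (Literature.Probability.Percolation.bondPercolation (Literature.Probability.LatticeModels.zdGraph 3) (Literature.Probability.Percolation.criticalProbI 3)).real {ω | ∃ S : Finset (Sym2 (Literature.Probability.LatticeModels.Site 3)),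 S.card ≤ k ∧ ¬ ∃ x ∈ Literature.Probability.LatticeModels.box 3 (n / 2), ∃ y ∈ Literature.Probability.LatticeModels.innerBoundary (Literature.Probability.LatticeModels.zdGraph 3) (Literature.Probability.LatticeModels.box 3 (12 * l * (n / 2))), (ω \ ↑S) ∈ Literature.Probability.Percolation.openConnIn ↑(Literature.Probability.LatticeModels.box 3 (12 * l * (n / 2))) x y} :=
  pinholeClosingHalved_proof

/-- **Why the guard is `2 ≤ n`.**  At `n = 1` the conclusion shape `box (n/2) → ∂ⁱⁿ box (12 l (n/2))` degenerates to
`box 0 → ∂ⁱⁿ box 0`, the EMPTY event (`box 3 0 = {0}` lies on its own inner boundary, `Negative.blockedEv_eq_empty`), so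
its probability vanishes and no positive `c'` could serve; the glue `closes_halved` only ever uses `n ≥ 2N + 2`. -/
theorem pinholeClosingHalved_conclusion_empty_at_one (k l : ℕ) :
    (Literature.Probability.Percolation.bondPercolation (Literature.Probability.LatticeModels.zdGraph 3) (Literature.Probability.Percolation.criticalProbI 3)).real {ω | ∃ S : Finset (Sym2 (Literature.Probability.LatticeModels.Site 3)), S.card ≤ k ∧ ¬ ∃ x ∈ Literature.Probability.LatticeModels.box 3 (1 / 2), ∃ y ∈ Literature.Probability.LatticeModels.innerBoundary (Literature.Probability.LatticeModels.zdGraph 3) (Literature.Probability.LatticeModels.box 3 (12 * l * (1 / 2))), (ω \ ↑S) ∈ Literature.Probability.Percolation.openConnIn ↑(Literature.Probability.LatticeModels.box 3 (12 * l * (1 / 2))) x y} = 0 := by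
  have h : (1 : ℕ) / 2 = 0 := rfl
  simp only [h, Nat.mul_zero]
  exact Negative.blockProb_eq_zero (k := k) (n := 0) (m := 0) le_rfl

end Summit.CriticalPhenomena.PercolationContinuityZ3.Theorems

end
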